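import Summits.BirchSwinnertonDyer.BirchSwinnertonDyer.Theorems.BiquadraticEisensteinDescentEisensteinHeartFlatCMInertBadKPrimeKatzHsiehLValueCM
import Summits.BirchSwinnertonDyer.Rank1Residual.X12.CMGoodOrdinarySplit
import Literature.NumberTheory.EllipticCurves.Rank1Residual.CMFieldDecompositionProofs
import HarnessLib

set_option linter.dupNamespace false -- `Summit.BirchSwinnertonDyer.BirchSwinnertonDyer.Theorems.…` (summit = sub)
set_option autoImplicit false

/-!
# Crux `EisensteinHeartFlatCMInertBadKPrime` (stmt-BirchSwinnertonDyer-21341), line `hsieh-lambda`, layer 2 (V2), hypothesis (L):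
# the two `K_CM`-element statements, DISCHARGED for the nine CM fields

Route `BiquadraticEisensteinDescent` (cell `pub/bsd-wall`, width seat `bsd-wall-cm-bed-w4`). THEOREMS ONLY (no definition, no named
fact, no `sorry`); supports stmt-BirchSwinnertonDyer-21341 as a helper; nothing about the crux's input or any case of BSD is asserted.

`…KatzHsiehLValueCM.hLval_of_deuring_of_cmField` (w3) reduces the hypothesis (L) of the Katz–Hsieh socket to Deuring's clauses, the
socket's (T), the quadratic frame data, and FIVE binders on the CM field `K₁` alone:

  `θ₀ : 𝓞 K₁`, `a : ℤ`, `hcθ : c • θ₀ = a − θ₀`,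
  `hθ : ∀ 𝔮, N(𝔮) = (N(𝔮).minFac)² → a − 2θ₀ ∉ 𝔮` («`∓√d_K` lies in no prime of residue degree two»),
  `hθram : ∀ ℓ 𝔮, ℓ ∈ 𝔮 → a − 2θ₀ ∈ 𝔮 → W bad at ℓ` («every rational prime below a prime containing `√d_K` is bad»).

This file PROVES them (`exists_theta_datum`) for `K₁` the CM field of `W` (`IsCMFieldOfJ K₁ W.j`, `W.j ∈ maximalCMJInvariants`)
and `c ≠ 1`: with `θ² = d_K`, take `θ₀ = (1 + θ)/2, a = 1` (seven odd `d_K`) or `θ₀ = θ/2, a = 0` (`d_K = −4, −8`); always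
`a − 2θ₀ = −θ`. Then `c θ = −θ`; `θ ∈ 𝔮 ⇒ N(𝔮) ∣ |N(θ)| = |d_K|`, impossible for `N(𝔮) = ℓ²` (`|d_K|` prime, or `ℓ = 2` and `𝔮 ∋ 1 + i`
resp. `√−2` of norm `2`); `θ, ℓ ∈ 𝔮 ⇒ ℓ ∣ d_K ⇒ W` bad at `ℓ` (tree `X12.not_good_of_cmRamified'`). The one-call form
`hLval_of_deuring_of_cmField_of_isCMFieldOfJ` is w3's theorem with these five binders gone.

References: [SilvermanATAEC1994] App. A §3 (the nine CM fields), Ch. II Ex. 2.30–2.32; [NeukirchANT1999] Ch. I §8 (8.2)–(8.4);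
[SilvermanAEC2009] Cor. VII.7.2.
-/

noncomputable section

open scoped NumberField Pointwise
open NumberField IsDedekindDomain Ideal Polynomial CongruenceSubgroup
open Literature.NumberTheory.GaloisRepresentations Literature.NumberTheory.EllipticCurves
open Literature.NumberTheory.EllipticCurves.Rank1Residual Literature.NumberTheory.EllipticCurves.ModularForms
open Summit.BirchSwinnertonDyer.BirchSwinnertonDyer.Theorems.BiquadraticEisensteinDescentEisensteinHeartFlatCMInertBadKPrimeKatzHsiehLValueCM

namespace Summit.BirchSwinnertonDyer.BirchSwinnertonDyer.Theorems.BiquadraticEisensteinDescentEisensteinHeartFlatCMInertBadKPrimeCMFieldTheta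

variable {K₁ : Type} [Field K₁] [NumberField K₁]

/-! ## §1 The non-trivial automorphism of a quadratic field negates a square root of a negative rational integer -/

/-- In a quadratic number field `K₁`, an element `θ` with `θ² = d`, `d < 0` an integer, is not rational. [folklore] -/
theorem ne_algebraMap_of_sq_eq_neg {θ : K₁} {d : ℤ} (hd : d < 0) (hθ : θ ^ 2 = (d : K₁)) (r : ℚ) :
    θ ≠ algebraMap ℚ K₁ r := by
  intro h
  have h1 : algebraMap ℚ K₁ (r ^ 2) = algebraMap ℚ K₁ (d : ℚ) := by
    rw [map_pow, ← h, hθ, map_intCast]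
  have h2 : r ^ 2 = (d : ℚ) := (algebraMap ℚ K₁).injective h1
  have h3 : (0 : ℚ) ≤ d := by rw [← h2]; positivity
  exact absurd hd (not_lt.mpr (by exact_mod_cast h3))

/-- **`c θ = −θ`**: in a quadratic number field `K₁`, a non-trivial `ℚ`-automorphism `c` negates every `θ` with `θ² = d`,
`d < 0` an integer (`(cθ)² = θ²` forces `cθ = ±θ`, and `cθ = θ` would make `c` fix the basis `{1, θ}`). [folklore] -/
theorem algEquiv_apply_eq_neg_of_sq_eq (h2 : Module.finrank ℚ K₁ = 2) {θ : K₁} {d : ℤ} (hd : d < 0)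
    (hθ : θ ^ 2 = (d : K₁)) {c : K₁ ≃ₐ[ℚ] K₁} (hc : c ≠ 1) : c θ = -θ := by
  have hsq : (c θ) ^ 2 = θ ^ 2 := by rw [← map_pow, hθ, map_intCast]
  have h0 : (c θ - θ) * (c θ + θ) = 0 := by linear_combination hsq
  rcases mul_eq_zero.mp h0 with h | h
  · exfalso
    apply hc
    have hfix : c θ = θ := sub_eq_zero.mp h
    have hli : LinearIndependent ℚ ![(1 : K₁), θ] := by
      refine LinearIndependent.pair_iff.mpr fun s t hst ↦ ?_
      by_cases ht : t = 0
      · subst ht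
        simp only [zero_smul, add_zero, smul_eq_zero, one_ne_zero, or_false] at hst
        exact ⟨hst, rfl⟩
      · exfalso
        apply ne_algebraMap_of_sq_eq_neg hd hθ (-s / t)
        have ht' : (algebraMap ℚ K₁ t) ≠ 0 := by
          rw [Ne, map_eq_zero]; exact ht
        rw [Algebra.smul_def, Algebra.smul_def, mul_one] at hst
        rw [map_div₀, map_neg, eq_div_iff ht', mul_comm]
        linear_combination hst
    have hcard : Fintype.card (Fin 2) = Module.finrank ℚ K₁ := by rw [Fintype.card_fin, h2]
    have hb := coe_basisOfLinearIndependentOfCardEqFinrank hli hcard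
    have hlin : c.toLinearMap = LinearMap.id :=
      (basisOfLinearIndependentOfCardEqFinrank hli hcard).ext fun i ↦ by
        fin_cases i
        · simp [hb]
        · simp [hb, hfix]
    ext x
    exact LinearMap.congr_fun hlin x
  · exact eq_neg_of_add_eq_zero_left h

/-! ## §2 Integrality of `θ` and of `(a + θ)/2` -/

omit [NumberField K₁] in
/-- `θ` with `θ² = d ∈ ℤ` is an algebraic integer. [folklore] -/
theorem isIntegral_of_sq_eq {θ : K₁} {d : ℤ} (hθ : θ ^ 2 = (d : K₁)) : IsIntegral ℤ θ := by
  refine IsIntegral.of_pow two_pos ?_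
  rw [hθ, show (d : K₁) = algebraMap ℤ K₁ d from (eq_intCast _ d).symm]
  exact isIntegral_algebraMap

/-- `(a + θ)/2` is an algebraic integer when `θ² = d` and `4 ∣ d − a²`: it is a root of `X² − aX − (d − a²)/4`
(e.g. `(1 + √d)/2` for `d ≡ 1 (mod 4)`, `√d/2 = i, √−2` for `d = −4, −8`). [folklore] -/
theorem isIntegral_half_add_of_sq_eq {θ : K₁} {d a e : ℤ} (hθ : θ ^ 2 = (d : K₁)) (he : d - a ^ 2 = 4 * e) :
    IsIntegral ℤ (((a : K₁) + θ) / 2) := by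
  refine ⟨X ^ 2 - C a * X - C e, by monicity!, ?_⟩
  simp only [eval₂_sub, eval₂_mul, eval₂_X_pow, eval₂_C, eval₂_X]
  simp only [eq_intCast]
  have he' : ((d : K₁)) - (a : K₁) ^ 2 = 4 * (e : K₁) := by exact_mod_cast congrArg (Int.cast : ℤ → K₁) he
  linear_combination (1 / 4 : K₁) * hθ + (1 / 4 : K₁) * he'

/-! ## §3 Norms: `x² = m ⇒ |N(x)| = |m|`, and membership in a prime bounds its norm -/

/-- In a quadratic number field, `x ∈ 𝓞 K₁` with `x² = m ∈ ℤ` has `|N_{K₁/ℚ}(x)| = |m|` (`N(x)² = N(m) = m²`). [folklore] -/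
theorem natAbs_norm_eq_of_sq_eq (h2 : Module.finrank ℚ K₁ = 2) {x : 𝓞 K₁} {m : ℤ} (hx : x ^ 2 = (m : 𝓞 K₁)) :
    (Algebra.norm ℤ x).natAbs = m.natAbs := by
  have h := congrArg (Algebra.norm ℤ) hx
  rw [map_pow, show (m : 𝓞 K₁) = algebraMap ℤ (𝓞 K₁) m from (eq_intCast _ m).symm, Algebra.norm_algebraMap,
    NumberField.RingOfIntegers.rank, h2] at h
  exact Int.natAbs_eq_iff_sq_eq.mpr h

/-- In a quadratic number field, `y ∈ 𝓞 K₁` with `y⁴ = −4` has `|N(y)| = 2` (`N(y)⁴ = 16`). Used for `y = 1 + i`. [folklore] -/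
theorem natAbs_norm_eq_two_of_pow_four (h2 : Module.finrank ℚ K₁ = 2) {y : 𝓞 K₁} (hy : y ^ 4 = (-4 : 𝓞 K₁)) :
    (Algebra.norm ℤ y).natAbs = 2 := by
  have h := congrArg (Algebra.norm ℤ) hy
  rw [map_pow, show (-4 : 𝓞 K₁) = algebraMap ℤ (𝓞 K₁) (-4) by simp, Algebra.norm_algebraMap,
    NumberField.RingOfIntegers.rank, h2] at h
  have h' : (Algebra.norm ℤ y).natAbs ^ 4 = 2 ^ 4 := by
    have := congrArg Int.natAbs h
    rw [Int.natAbs_pow, Int.natAbs_pow] at this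
    simpa using this
  exact Nat.pow_left_injective (by norm_num : 4 ≠ 0) h'

/-- `x ∈ 𝔮 ⇒ N(𝔮) ∣ |N(x)|`. [cite: NeukirchANT1999, Ch. I §6 (6.2)] -/
theorem absNorm_dvd_natAbs_norm_of_mem {𝔮 : HeightOneSpectrum (𝓞 K₁)} {x : 𝓞 K₁} (hx : x ∈ 𝔮.asIdeal) :
    Ideal.absNorm 𝔮.asIdeal ∣ (Algebra.norm ℤ x).natAbs := by
  rw [← Ideal.absNorm_span_singleton]
  exact Ideal.absNorm_dvd_absNorm_of_le ((Ideal.span_singleton_le_iff_mem _).mpr hx)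

omit [NumberField K₁] in
/-- A rational prime `ℓ` and an integer `m` in a proper ideal: `ℓ ∣ m` (else `1 = uℓ + vm ∈ 𝔮`). [folklore] -/
theorem natCast_dvd_of_intCast_mem {𝔮 : Ideal (𝓞 K₁)} (h𝔮 : 𝔮 ≠ ⊤) {ℓ : ℕ} (hℓ : ℓ.Prime) (hℓ𝔮 : (ℓ : 𝓞 K₁) ∈ 𝔮)
    {m : ℤ} (hm : (m : 𝓞 K₁) ∈ 𝔮) : (ℓ : ℤ) ∣ m := by
  by_contra h
  have hcop : IsCoprime (ℓ : ℤ) m := (Prime.coprime_iff_not_dvd (Nat.prime_iff_prime_int.mp hℓ)).mpr h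
  obtain ⟨u, v, huv⟩ := hcop
  apply h𝔮
  rw [Ideal.eq_top_iff_one]
  have : ((u * ℓ + v * m : ℤ) : 𝓞 K₁) ∈ 𝔮 := by
    push_cast
    exact 𝔮.add_mem (𝔮.mul_mem_left _ hℓ𝔮) (𝔮.mul_mem_left _ hm)
  rwa [huv, Int.cast_one] at this

/-- `ℓ² ∤ q` for primes `ℓ, q`. [folklore] -/
theorem not_sq_dvd_prime {ℓ q : ℕ} (hℓ : ℓ.Prime) (hq : q.Prime) : ¬ ℓ ^ 2 ∣ q := by
  intro h
  have hℓq : ℓ = q := (Nat.prime_dvd_prime_iff_eq hℓ hq).mp (dvd_trans (dvd_pow_self ℓ two_ne_zero) h)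
  subst hℓq
  have h' : ℓ ^ 2 ∣ ℓ ^ 1 := by rwa [pow_one]
  have := (Nat.pow_dvd_pow_iff_le_right hℓ.one_lt).mp h'
  omega

/-- For a finite prime `𝔮`, `N(𝔮) ≠ 1`, so `N(𝔮).minFac` is prime (the residue characteristic). [folklore] -/
theorem minFac_absNorm_prime (𝔮 : HeightOneSpectrum (𝓞 K₁)) : (Ideal.absNorm 𝔮.asIdeal).minFac.Prime := by
  refine Nat.minFac_prime fun h1 ↦ ?_
  exact 𝔮.isPrime.ne_top (Ideal.absNorm_eq_one_iff.mp h1)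

/-! ## §4 The frame `Θ = θ`, `θ₀ = (a + θ)/2` and the generic datum -/

/-- **The frame.** For `θ² = d < 0`, `4 ∣ d − a²` (`e = (d − a²)/4`) and `c ≠ 1`: the algebraic integers `Θ = θ`,
`θ₀ = (a + θ)/2` satisfy `Θ² = d`, `a − 2θ₀ = −Θ`, `c θ₀ = a − θ₀` and `θ₀² = aθ₀ + e`. [folklore] -/
theorem exists_frame (h2 : Module.finrank ℚ K₁ = 2) {θ : K₁} {d a e : ℤ} (hd : d < 0) (hθ : θ ^ 2 = (d : K₁))
    (he : d - a ^ 2 = 4 * e) {c : K₁ ≃ₐ[ℚ] K₁} (hc : c ≠ 1) :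
    ∃ Θ θ₀ : 𝓞 K₁, Θ ^ 2 = ((d : ℤ) : 𝓞 K₁) ∧ (a : 𝓞 K₁) - 2 * θ₀ = -Θ ∧ c • θ₀ = (a : 𝓞 K₁) - θ₀ ∧
      θ₀ ^ 2 = (a : 𝓞 K₁) * θ₀ + (e : 𝓞 K₁) := by
  have he' : ((d : K₁)) - (a : K₁) ^ 2 = 4 * (e : K₁) := by exact_mod_cast congrArg (Int.cast : ℤ → K₁) he
  refine ⟨⟨θ, isIntegral_of_sq_eq hθ⟩, ⟨((a : K₁) + θ) / 2, isIntegral_half_add_of_sq_eq hθ he⟩, ?_, ?_, ?_, ?_⟩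
  · apply RingOfIntegers.ext
    simp only [map_pow, map_intCast, RingOfIntegers.map_mk]
    exact hθ
  · apply RingOfIntegers.ext
    simp only [map_sub, map_mul, map_intCast, map_ofNat, map_neg, RingOfIntegers.map_mk]
    ring
  · apply RingOfIntegers.ext
    change c (((a : K₁) + θ) / 2) = _
    simp only [map_sub, map_intCast, RingOfIntegers.map_mk]
    rw [map_div₀, map_add, map_intCast, map_ofNat, algEquiv_apply_eq_neg_of_sq_eq h2 hd hθ hc]
    ring
  · apply RingOfIntegers.ext
    simp only [map_pow, map_add, map_mul, map_intCast, RingOfIntegers.map_mk]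
    linear_combination (1 / 4 : K₁) * hθ + (1 / 4 : K₁) * he'

/-- **The generic datum.** If `Θ² = d`, `a − 2θ₀ = −Θ`, `c θ₀ = a − θ₀`, `Θ` lies in no prime of norm `ℓ²`, and every
prime `ℓ ∣ d` is bad for `W`, then `(θ₀, a)` is a `K_CM`-element datum (`ℓ, Θ ∈ 𝔮 ⇒ d = Θ² ∈ 𝔮 ⇒ ℓ ∣ d`). [folklore] -/
theorem exists_datum_of_frame (W : WeierstrassCurve ℚ) {c : K₁ ≃ₐ[ℚ] K₁} {Θ θ₀ : 𝓞 K₁} {d a : ℤ}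
    (hΘsq : Θ ^ 2 = ((d : ℤ) : 𝓞 K₁)) (hkey : (a : 𝓞 K₁) - 2 * θ₀ = -Θ) (hcθ : c • θ₀ = (a : 𝓞 K₁) - θ₀)
    (hno : ∀ 𝔮 : HeightOneSpectrum (𝓞 K₁), Ideal.absNorm 𝔮.asIdeal = (Ideal.absNorm 𝔮.asIdeal).minFac ^ 2 →
      Θ ∉ 𝔮.asIdeal)
    (hbad : ∀ (ℓ : ℕ) [Fact ℓ.Prime], (ℓ : ℤ) ∣ d → ¬ W.HasGoodReductionAtPrime ℓ) :
    ∃ (θ₀ : 𝓞 K₁) (a : ℤ), c • θ₀ = (a : 𝓞 K₁) - θ₀ ∧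
      (∀ 𝔮 : HeightOneSpectrum (𝓞 K₁), Ideal.absNorm 𝔮.asIdeal = (Ideal.absNorm 𝔮.asIdeal).minFac ^ 2 →
        (a : 𝓞 K₁) - 2 * θ₀ ∉ 𝔮.asIdeal) ∧
      (∀ (ℓ : ℕ) [Fact ℓ.Prime] (𝔮 : HeightOneSpectrum (𝓞 K₁)), (ℓ : 𝓞 K₁) ∈ 𝔮.asIdeal →
        (a : 𝓞 K₁) - 2 * θ₀ ∈ 𝔮.asIdeal → ¬ W.HasGoodReductionAtPrime ℓ) := by
  refine ⟨θ₀, a, hcθ, fun 𝔮 hN hmem ↦ ?_, fun ℓ _ 𝔮 hℓ hmem ↦ ?_⟩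
  · rw [hkey, neg_mem_iff] at hmem
    exact hno 𝔮 hN hmem
  · rw [hkey, neg_mem_iff] at hmem
    have hd𝔮 : ((d : ℤ) : 𝓞 K₁) ∈ 𝔮.asIdeal := by
      rw [← hΘsq, sq]; exact 𝔮.asIdeal.mul_mem_left _ hmem
    exact hbad ℓ (natCast_dvd_of_intCast_mem 𝔮.isPrime.ne_top (Fact.out) hℓ hd𝔮)

/-! ## §5 `Θ` lies in no prime of norm `ℓ²`: `|d|` prime, `d = −8`, `d = −4` -/

/-- `|d|` prime (the seven fields `d ∈ {−3, −7, −11, −19, −43, −67, −163}`): `Θ ∈ 𝔮 ⇒ ℓ² = N(𝔮) ∣ |N(Θ)| = |d|`, impossible.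
[cite: SilvermanATAEC1994, App. A §3] -/
theorem not_mem_of_natAbs_prime (h2 : Module.finrank ℚ K₁ = 2) {Θ : 𝓞 K₁} {d : ℤ} (hΘsq : Θ ^ 2 = ((d : ℤ) : 𝓞 K₁))
    (hdp : d.natAbs.Prime) (𝔮 : HeightOneSpectrum (𝓞 K₁))
    (hN : Ideal.absNorm 𝔮.asIdeal = (Ideal.absNorm 𝔮.asIdeal).minFac ^ 2) : Θ ∉ 𝔮.asIdeal := fun hmem ↦ by
  have hdvd := absNorm_dvd_natAbs_norm_of_mem hmem
  rw [natAbs_norm_eq_of_sq_eq h2 hΘsq, hN] at hdvd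
  exact not_sq_dvd_prime (minFac_absNorm_prime 𝔮) hdp hdvd

/-- `d = −8` (`θ₀ = √−2`, `Θ = 2θ₀`): `2θ₀ ∈ 𝔮 ⇒ θ₀ ∈ 𝔮` (through `θ₀² = −2` if `2 ∈ 𝔮`) `⇒ ℓ² ∣ |N(θ₀)| = 2`, impossible.
[cite: SilvermanATAEC1994, App. A §3] -/
theorem not_mem_of_neg_eight (h2 : Module.finrank ℚ K₁ = 2) {Θ θ₀ : 𝓞 K₁} (hθ₀sq : θ₀ ^ 2 = ((-2 : ℤ) : 𝓞 K₁))
    (h2θ₀ : 2 * θ₀ = Θ) (𝔮 : HeightOneSpectrum (𝓞 K₁))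
    (hN : Ideal.absNorm 𝔮.asIdeal = (Ideal.absNorm 𝔮.asIdeal).minFac ^ 2) : Θ ∉ 𝔮.asIdeal := fun hmem ↦ by
  rw [← h2θ₀] at hmem
  have hθ₀mem : θ₀ ∈ 𝔮.asIdeal := by
    rcases 𝔮.isPrime.mem_or_mem hmem with h | h
    · apply 𝔮.isPrime.mem_of_pow_mem 2
      rw [hθ₀sq, show ((-2 : ℤ) : 𝓞 K₁) = -(2 : 𝓞 K₁) by simp, neg_mem_iff]
      exact h
    · exact h
  have hdvd := absNorm_dvd_natAbs_norm_of_mem hθ₀mem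
  rw [natAbs_norm_eq_of_sq_eq h2 hθ₀sq, hN] at hdvd
  exact not_sq_dvd_prime (minFac_absNorm_prime 𝔮) Nat.prime_two (by simpa using hdvd)

/-- `d = −4` (`Θ² = −4`, `θ₀ = i`): `Θ ∈ 𝔮 ⇒ ℓ² ∣ 4 ⇒ N(𝔮) = 4 ⇒ 2 ∈ 𝔮 ⇒ (1 + i)² = 2i ∈ 𝔮 ⇒ 1 + i ∈ 𝔮 ⇒ 4 ∣ |N(1 + i)| = 2`,
impossible (there is no prime of norm `4` in a quadratic field containing `i`). [cite: SilvermanATAEC1994, App. A §3] -/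
theorem not_mem_of_neg_four (h2 : Module.finrank ℚ K₁ = 2) {Θ θ₀ : 𝓞 K₁} (hΘsq : Θ ^ 2 = ((-4 : ℤ) : 𝓞 K₁))
    (hθ₀sq : θ₀ ^ 2 = ((-1 : ℤ) : 𝓞 K₁)) (𝔮 : HeightOneSpectrum (𝓞 K₁))
    (hN : Ideal.absNorm 𝔮.asIdeal = (Ideal.absNorm 𝔮.asIdeal).minFac ^ 2) : Θ ∉ 𝔮.asIdeal := fun hmem ↦ by
  have hℓ := minFac_absNorm_prime 𝔮
  set ℓ := (Ideal.absNorm 𝔮.asIdeal).minFac with hℓdef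
  -- `ℓ² ∣ 4`, so `ℓ = 2` and `N(𝔮) = 4`
  have hdvd := absNorm_dvd_natAbs_norm_of_mem hmem
  rw [natAbs_norm_eq_of_sq_eq h2 hΘsq, hN] at hdvd
  have hℓ2 : ℓ = 2 := by
    have h4 : ℓ ∣ 2 ^ 2 := dvd_trans (dvd_pow_self ℓ two_ne_zero) (by simpa using hdvd)
    exact (Nat.prime_dvd_prime_iff_eq hℓ Nat.prime_two).mp (hℓ.dvd_of_dvd_pow h4)
  have hN4 : Ideal.absNorm 𝔮.asIdeal = 4 := by rw [hN, hℓ2]; norm_num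
  -- `2 ∈ 𝔮`
  have h2mem : (2 : 𝓞 K₁) ∈ 𝔮.asIdeal := by
    have h4mem : ((Ideal.absNorm 𝔮.asIdeal : ℕ) : 𝓞 K₁) ∈ 𝔮.asIdeal := Ideal.absNorm_mem _
    rw [hN4, show ((4 : ℕ) : 𝓞 K₁) = 2 * 2 by norm_num] at h4mem
    exact (𝔮.isPrime.mem_or_mem h4mem).elim id id
  -- `(1 + θ₀)² = 2θ₀ ∈ 𝔮`, so `1 + θ₀ ∈ 𝔮`; and `(1 + θ₀)⁴ = −4`, so `|N(1 + θ₀)| = 2`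
  have hm1 : θ₀ ^ 2 = -1 := by rw [hθ₀sq]; simp
  have hsq1 : (1 + θ₀) ^ 2 = 2 * θ₀ := by linear_combination hm1
  have h1mem : 1 + θ₀ ∈ 𝔮.asIdeal := by
    apply 𝔮.isPrime.mem_of_pow_mem 2
    rw [hsq1]; exact 𝔮.asIdeal.mul_mem_right _ h2mem
  have hpow4 : (1 + θ₀) ^ 4 = (-4 : 𝓞 K₁) := by
    rw [show (4 : ℕ) = 2 * 2 from rfl, pow_mul, hsq1]
    linear_combination (4 : 𝓞 K₁) * hm1
  have hdvd1 := absNorm_dvd_natAbs_norm_of_mem h1mem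
  rw [natAbs_norm_eq_two_of_pow_four h2 hpow4, hN4] at hdvd1
  omega

/-! ## §6 Assembly over the nine CM fields, and the one-call form of (L) -/

/-- **THE `K_CM`-ELEMENT DATUM of `…KatzHsiehLValueCM.hLval_of_deuring_of_cmField`, for every maximal-order CM curve.**
For `W/ℚ` CM with `W.j ∈ maximalCMJInvariants`, `K₁` its CM field (`IsCMFieldOfJ K₁ W.j`) and `c ≠ 1` its non-trivial
automorphism, there are `θ₀ ∈ 𝓞 K₁`, `a ∈ ℤ` with `c • θ₀ = a − θ₀`, `a − 2θ₀` in no prime of `K₁` of norm `ℓ²`, and every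
rational prime `ℓ` lying, together with `a − 2θ₀`, in a prime of `K₁` a BAD prime of `W` (such `ℓ` divide `d_K`, i.e. are
ramified in the CM field: tree `X12.not_good_of_cmRamified'`). `θ₀ = (1 + √d_K)/2, a = 1` for the seven odd `d_K`,
`θ₀ = √d_K/2, a = 0` for `d_K = −4, −8` (`cmFieldDiscr_mem`). [cite: SilvermanATAEC1994, App. A §3] [cite: SilvermanAEC2009, Cor. VII.7.2] -/
theorem exists_theta_datum (W : WeierstrassCurve ℚ) [W.IsElliptic] [W.IsGloballyMinimal] (hCM : W.HasCM)
    (hj : W.j ∈ maximalCMJInvariants) (hK₁ : IsCMFieldOfJ K₁ W.j) {c : K₁ ≃ₐ[ℚ] K₁} (hc : c ≠ 1) :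
    ∃ (θ₀ : 𝓞 K₁) (a : ℤ), c • θ₀ = (a : 𝓞 K₁) - θ₀ ∧
      (∀ 𝔮 : HeightOneSpectrum (𝓞 K₁), Ideal.absNorm 𝔮.asIdeal = (Ideal.absNorm 𝔮.asIdeal).minFac ^ 2 →
        (a : 𝓞 K₁) - 2 * θ₀ ∉ 𝔮.asIdeal) ∧
      (∀ (ℓ : ℕ) [Fact ℓ.Prime] (𝔮 : HeightOneSpectrum (𝓞 K₁)), (ℓ : 𝓞 K₁) ∈ 𝔮.asIdeal →
        (a : 𝓞 K₁) - 2 * θ₀ ∈ 𝔮.asIdeal → ¬ W.HasGoodReductionAtPrime ℓ) := by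
  obtain ⟨h2, θ, hθ⟩ := hK₁
  set d : ℤ := cmFieldDiscr W.j with hd_def
  have hd : d < 0 := hd_def ▸ cmFieldDiscr_neg hj
  have hbad : ∀ (ℓ : ℕ) [Fact ℓ.Prime], (ℓ : ℤ) ∣ d → ¬ W.HasGoodReductionAtPrime ℓ := by
    intro ℓ _ hℓd
    have hram : CMRamified W ℓ := by
      change (ℓ : ℤ) ∣ cmFieldDiscrOfJ W.j
      rwa [cmFieldDiscrOfJ_eq_cmFieldDiscr hj]
    exact Summit.BirchSwinnertonDyer.Rank1Residual.X12.not_good_of_cmRamified' W ℓ hCM hram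
  -- odd `d`: `|d|` prime and `d − 1 = 4e`, frame with `a = 1`
  have hodd : ∀ e : ℤ, d.natAbs.Prime → d - 1 ^ 2 = 4 * e → ∃ (θ₀ : 𝓞 K₁) (a : ℤ), c • θ₀ = (a : 𝓞 K₁) - θ₀ ∧
      (∀ 𝔮 : HeightOneSpectrum (𝓞 K₁), Ideal.absNorm 𝔮.asIdeal = (Ideal.absNorm 𝔮.asIdeal).minFac ^ 2 →
        (a : 𝓞 K₁) - 2 * θ₀ ∉ 𝔮.asIdeal) ∧
      (∀ (ℓ : ℕ) [Fact ℓ.Prime] (𝔮 : HeightOneSpectrum (𝓞 K₁)), (ℓ : 𝓞 K₁) ∈ 𝔮.asIdeal →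
        (a : 𝓞 K₁) - 2 * θ₀ ∈ 𝔮.asIdeal → ¬ W.HasGoodReductionAtPrime ℓ) := fun e hdp he ↦ by
    obtain ⟨Θ, θ₀, hΘsq, hkey, hcθ, -⟩ := exists_frame h2 hd hθ he hc
    exact exists_datum_of_frame W hΘsq hkey hcθ (not_mem_of_natAbs_prime h2 hΘsq hdp) hbad
  have hmem := cmFieldDiscr_mem hj
  rw [← hd_def] at hmem
  simp only [Finset.mem_insert, Finset.mem_singleton] at hmem
  rcases hmem with h | h | h | h | h | h | h | h | h
  · exact hodd (-1) (by rw [h]; norm_num) (by rw [h]; norm_num)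
  · -- `d = −4`: frame with `a = 0`, `e = −1` (`θ₀ = i`)
    obtain ⟨Θ, θ₀, hΘsq, hkey, hcθ, hθ₀sq⟩ := exists_frame (a := 0) (e := -1) h2 hd hθ (by rw [h]; norm_num) hc
    rw [h] at hΘsq hbad
    simp only [Int.cast_zero, zero_mul, zero_add] at hθ₀sq
    exact exists_datum_of_frame W hΘsq hkey hcθ (not_mem_of_neg_four h2 hΘsq hθ₀sq) hbad
  · exact hodd (-2) (by rw [h]; norm_num) (by rw [h]; norm_num)
  · -- `d = −8`: frame with `a = 0`, `e = −2` (`θ₀ = √−2`)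
    obtain ⟨Θ, θ₀, hΘsq, hkey, hcθ, hθ₀sq⟩ := exists_frame (a := 0) (e := -2) h2 hd hθ (by rw [h]; norm_num) hc
    have h2θ₀ : 2 * θ₀ = Θ := by linear_combination -hkey
    rw [h] at hΘsq hbad
    simp only [Int.cast_zero, zero_mul, zero_add] at hθ₀sq
    exact exists_datum_of_frame W hΘsq hkey hcθ (not_mem_of_neg_eight h2 hθ₀sq h2θ₀) hbad
  · exact hodd (-3) (by rw [h]; norm_num) (by rw [h]; norm_num)
  · exact hodd (-5) (by rw [h]; norm_num) (by rw [h]; norm_num)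
  · exact hodd (-11) (by rw [h]; norm_num) (by rw [h]; norm_num)
  · exact hodd (-17) (by rw [h]; norm_num) (by rw [h]; norm_num)
  · exact hodd (-41) (by rw [h]; norm_num) (by rw [h]; norm_num)

/-- **HYPOTHESIS (L) OF THE KATZ–HSIEH SOCKET, ONE CALL, with the `K_CM`-element binders discharged.** This is w3's
`…KatzHsiehLValueCM.hLval_of_deuring_of_cmField` with `θ₀ a hcθ hθ hθram` supplied by `exists_theta_datum`; the price is the three
identifications `W.j ∈ maximalCMJInvariants`, `IsCMFieldOfJ K₁ W.j`, `c ≠ 1` (exactly the hypotheses under which the route's Deuring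
input `Deuring_exists_heckeCharacter_of_maximalCM` supplies `ψ`). Remaining binders: (T) (`hT`), Deuring (i),(iv) for `ψ`, `hψbad`,
the newform/CM hypotheses, the quadratic frame data `h2K h2L h2L₁ τ hτ hτc`, `ν = ‖·‖`. Nothing about the crux's input is asserted.
[cite: SilvermanATAEC1994, Ch. II Thm. 10.5 (b), App. A §3] [cite: Hsieh2014mu, Prop. 4.9 (§4.8)] -/
theorem hLval_of_deuring_of_cmField_of_isCMFieldOfJ {K L : Type} [Field K] [NumberField K] [Field L] [NumberField L]
    [Algebra K₁ L] [IsGalois K₁ L] [Algebra K L] [IsGalois K L]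
    [IsTotallyComplex L] [IsCMField L] [IsTotallyComplex K] [IsTotallyComplex K₁] [IsGalois ℚ K₁]
    {p : ℕ} [Fact p.Prime] {ι : PadicAlgCl p ≃+* ℂ} {Sp : Finset (HeightOneSpectrum (𝓞 L))} (hSp : KatzCM.IsPAdicCMType p Sp)
    (W : WeierstrassCurve ℚ) [W.IsElliptic] [W.IsGloballyMinimal] [NeZero (W.conductorNorm ℤ)] (hCM : W.HasCM)
    (hj : W.j ∈ maximalCMJInvariants) (hK₁ : IsCMFieldOfJ K₁ W.j)
    {c : K₁ ≃ₐ[ℚ] K₁} (hc : c ≠ 1) {ψ : HeckeCharacter K₁} (hψ1 : ψ.HasInfinityType (fun _ ↦ 1) (fun _ ↦ 0))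
    (hψgood : ∀ (ℓ : ℕ) [Fact ℓ.Prime], W.HasGoodReductionAtPrime ℓ →
      ∀ 𝔮 : HeightOneSpectrum (𝓞 K₁), (ℓ : 𝓞 K₁) ∈ 𝔮.asIdeal →
        ψ.IsUnramifiedAt 𝔮 ∧
        (c • 𝔮 ≠ 𝔮 →
          ψ.valueAtUniformizer 𝔮 + ψ.valueAtUniformizer (c • 𝔮) = (W.frobeniusTrace ℓ : ℂ) ∧
          ψ.valueAtUniformizer 𝔮 * ψ.valueAtUniformizer (c • 𝔮) = (ℓ : ℂ)) ∧
        (c • 𝔮 = 𝔮 → W.frobeniusTrace ℓ = 0 ∧ ψ.valueAtUniformizer 𝔮 = -(ℓ : ℂ)))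
    (hψbad : ∀ (ℓ : ℕ) [Fact ℓ.Prime], ¬ W.HasGoodReductionAtPrime ℓ →
      ∀ w : HeightOneSpectrum (𝓞 L), (ℓ : 𝓞 L) ∈ w.asIdeal → ¬ (ψ.compRelNorm L).IsUnramifiedAt w)
    {f : CuspForm (Gamma0 (W.conductorNorm ℤ)) 2} (hf : IsNewformOf W f)
    (h2K : Module.finrank ℚ K = 2) (h2L : Module.finrank K L = 2)
    (h2L₁ : Module.finrank K₁ L = 2) {τ : L ≃ₐ[K] L} (hτ : τ ≠ 1) (hτc : (τ.restrictScalars ℚ).restrictNormal K₁ = c)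
    {ν : HeckeCharacter L} (hν : ∀ x : ideleGroup L, ((ν x : ℂˣ) : ℂ) = ((ideleNorm x : ℝ) : ℂ) ^ (1 : ℂ))
    {κ_ : ℕ → InfinitePlace L → ℕ}
    (hT : ∀ (χ : HeckeCharacter K) (n : ℕ), 0 < n → (∀ v : HeightOneSpectrum (𝓞 K), χ.IsUnramifiedAt v) →
      χ.HasInfinityType (fun _ ↦ (n : ℤ)) (fun _ ↦ -(n : ℤ)) →
      KatzCM.HasKatzType ι Sp (ψ.compRelNorm L * ν * χ.compRelNorm L) 1 (κ_ n)) :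
    ∀ (χ : HeckeCharacter K) (n : ℕ), 0 < n → (∀ v : HeightOneSpectrum (𝓞 K), χ.IsUnramifiedAt v) →
      χ.HasInfinityType (fun _ ↦ (n : ℤ)) (fun _ ↦ -(n : ℤ)) →
      ∀ hL : LFunction.HasEntireContinuation (heckeLFunction (ψ.compRelNorm L * ν * χ.compRelNorm L)),
        hL.continuation 0 = 1 * 1 ^ n * rankinSelbergValueHecke f χ 1 := by
  obtain ⟨θ₀, a, hcθ, hθ, hθram⟩ := exists_theta_datum W hCM hj hK₁ hc
  exact hLval_of_deuring_of_cmField hSp W hCM c hψ1 hψgood hψbad hf hK₁.1 h2K h2L h2L₁ hτ hτc θ₀ a hcθ hθ hθram hν hT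

end Summit.BirchSwinnertonDyer.BirchSwinnertonDyer.Theorems.BiquadraticEisensteinDescentEisensteinHeartFlatCMInertBadKPrimeCMFieldTheta

end
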